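import Literature.AlgebraicGeometry.HodgeTheory.AlgebraicityLocus
import Literature.AlgebraicGeometry.HodgeTheory.MotivatedClassesDeformationInputs
import HarnessLib

/-!
# The algebraicity locus of a global class as an increasing union of Zariski-closed strata (consequences of Charles–Schnell 2014, proof of Prop. 11.3.11)

Topic `Literature/AlgebraicGeometry/HodgeTheory` (family `hodge`), companion of
`AlgebraicityLocus.lean`. That file records, as the named fact
`charlesSchnell_algebraicityLocus_iUnion_closed` (Charles–Schnell, *Notes on absolute Hodge
classes*, proof of Prop. 11.3.11; Voisin, *Hodge Theory II*, §3.3.1, §7.3.2; Voisin 2007, §0), that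
for a smooth projective family `f : 𝒳 ⟶ S` (`Motives.IsSmoothProjectiveFamily f n`) with `𝒳`, `S`
quasi-projective and `S` smooth over `ℂ`, the ALGEBRAICITY LOCUS
`{t ∈ S(ℂ) | A|_{𝒳_t} ∈ algebraicClasses (𝒳_t) p}` of a global class `A ∈ H²ᵖ(𝒳(ℂ); ℂ)` is
`⋃_j W_j(ℂ)` for countably many Zariski-closed `W_j ⊆ S`. Consumers (the variational Hodge
statements of routes `HodgeConjecture/HeckePrymWeil`, `…/AnchorTransport`) want the locus presented as
an INCREASING countable union `⋃_d T_d` of sets that are Zariski closed on points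
(`Motives.IsZariskiClosedOnPoints`, `Motives/FamiliesVHS.lean`): "`A|_t` lies in the span of classes of
subschemes drawn from the first `d` components of the relative Hilbert scheme". This file proves
that presentation GRANTED the fact (sorry-free; the fact is an explicit hypothesis `hF`):

* `exists_monotone_isZariskiClosedOnPoints_of_eq_iUnion` — pure bookkeeping over any fields
  `k ⊆ L`: a countable union `⋃_j W_j(L)` of Zariski-closed-on-points sets of `L`-points is an
  increasing one, `T_d = (⋃_{j ≤ d} W_j)(L)` (finite unions of closed sets are closed);
* `charlesSchnell_algebraicityLocus_iUnion_closed.exists_monotone_strata` — granted the fact, for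
  `f : 𝒳 ⟶ S` a smooth projective family of relative dimension `n` with `𝒳`, `S` quasi-projective
  and `S` smooth, and any `A ∈ H²ᵖ(𝒳(ℂ); ℂ)`, the algebraicity locus is `⋃_d T_d` with `T` monotone
  and every `T_d` Zariski closed on points;
* `….exists_monotone_strata_of_isClosedImmersion` — the same for `f` projective in Hartshorne's
  sense (`𝒳 ↪ ℙᴺ × S` a closed immersion over `S`, the shape of `Andre1996_deformation`) over a smooth
  quasi-projective base: the total space is then quasi-projective
  (`IsQuasiProjectiveOver.of_isClosedImmersion_projectiveSpace_tensor`).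

What is NOT here: the statement for `f` merely proper and smooth with projective fibres, or over a
base that is only smooth and quasi-compact (possibly non-separated / not quasi-projective) — true on
paper (spreading out and specialisation of cycles, Fulton 1998 §10.1, §20.3) but theorems to be
proved, see "What is NOT here" in `AlgebraicityLocus.lean`; and the fact itself (no relative Hilbert
schemes, no cycle classes of relative cycles in `complexBetti` in the tree).

## References

* [CharlesSchnell2014Notes] F. Charles, C. Schnell, Notes on absolute Hodge classes, in Hodge
  Theory (Princeton Math. Notes 49, 2014), Prop. 11.3.11 (proof), §11.3.3.
* [VoisinHodgeII2003] C. Voisin, Hodge Theory and Complex Algebraic Geometry II (2003), §3.3.1,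
  §7.3.2 (proof of Thm. 7.19).
* [Voisin2007HodgeLoci] C. Voisin, Hodge loci and absolute Hodge classes, Compositio Math. 143
  (2007), §0.
* [Hartshorne1977] R. Hartshorne, Algebraic Geometry (1977), Ch. II §4 (projective morphisms).
-/

noncomputable section

open CategoryTheory AlgebraicGeometry MonoidalCategory CartesianMonoidalCategory _root_.Topology

universe u

namespace Literature.AlgebraicGeometry.HodgeTheory

section HodgeTheory

/-! ### Countable unions of Zariski-closed-on-points sets are increasing ones -/

/-- **Reshaping a countable union of Zariski-closed-on-points sets into an increasing one.** For a
`k`-scheme `T`, a field `L ⊇ k` and countably many Zariski-closed `W_j ⊆ T`: if a set `A ⊆ T(L)` of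
`L`-points is `⋃_j W_j(L)` (`W_j(L) = {t | pt(t) ∈ W_j}`), then `A = ⋃_d T_d` with
`T_d = (⋃_{j ≤ d} W_j)(L)` monotone in `d` and every `T_d` Zariski closed on points
(`Motives.IsZariskiClosedOnPoints`; a finite union of closed sets is closed). Pure bookkeeping.
[folklore] -/
theorem exists_monotone_isZariskiClosedOnPoints_of_eq_iUnion {k : Type u} [Field k] {L : Type u}
    [Field L] [Algebra k L] {T : Motives.SchemeOver k} {A : Set (Motives.AlgPoints T L)}
    (W : ℕ → Set T.left) (hW : ∀ j, IsClosed (W j))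
    (hA : A = ⋃ j, {t : Motives.AlgPoints T L | t.pt ∈ W j}) :
    ∃ T' : ℕ → Set (Motives.AlgPoints T L), Monotone T' ∧
      (∀ d, Motives.IsZariskiClosedOnPoints T (T' d)) ∧ A = ⋃ d, T' d := by
  refine ⟨fun d => {t | t.pt ∈ ⋃ j ∈ Set.Iic d, W j}, ?_, ?_, ?_⟩
  · intro d e hde t ht
    simp only [Set.mem_setOf_eq, Set.mem_iUnion, Set.mem_Iic] at ht ⊢
    obtain ⟨j, hj, hjt⟩ := ht
    exact ⟨j, hj.trans hde, hjt⟩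
  · intro d
    exact ⟨⋃ j ∈ Set.Iic d, W j, (Set.finite_Iic d).isClosed_biUnion fun j _ => hW j, rfl⟩
  · rw [hA]
    ext t
    simp only [Set.mem_iUnion, Set.mem_setOf_eq, Set.mem_Iic]
    constructor
    · rintro ⟨j, hj⟩
      exact ⟨j, j, le_rfl, hj⟩
    · rintro ⟨-, j, -, hj⟩
      exact ⟨j, hj⟩

/-! ### The algebraicity locus as an increasing union of strata, granted the fact -/

namespace charlesSchnell_algebraicityLocus_iUnion_closed

variable (hF : charlesSchnell_algebraicityLocus_iUnion_closed) {𝒳 S : Motives.SchemeOver ℂ}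
  (f : 𝒳 ⟶ S) {n : ℕ}

include hF

/-- **The algebraicity locus is an increasing countable union of Zariski-closed-on-points strata**
(granted the Charles–Schnell fact): for `f : 𝒳 ⟶ S` a smooth projective family of relative
dimension `n` with `𝒳`, `S` quasi-projective and `S` smooth over `ℂ`, an integer `p` and a global
class `A ∈ H²ᵖ(𝒳(ℂ); ℂ)`, there is a monotone sequence `T_d ⊆ S(ℂ)` of sets Zariski closed on points
with `{t | A|_{𝒳_t} ∈ algebraicClasses (𝒳_t) p} = ⋃_d T_d` (`T_d = (W_0 ∪ ⋯ ∪ W_d)(ℂ)` for the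
closed `W_j` of the fact; in print, "the first `d` components of the relative Hilbert scheme").
[cite: CharlesSchnell2014Notes, Prop. 11.3.11 (proof)] -/
theorem exists_monotone_strata (h𝒳 : IsQuasiProjectiveOver 𝒳) (hS : IsQuasiProjectiveOver S)
    (hSsm : AlgebraicGeometry.Smooth S.hom) (hf : Motives.IsSmoothProjectiveFamily f n) (p : ℕ)
    (A : complexBetti 𝒳 (2 * p)) :
    ∃ T : ℕ → Set (Motives.ComplexPoints S), Monotone T ∧
      (∀ d, Motives.IsZariskiClosedOnPoints S (T d)) ∧
        {t : Motives.ComplexPoints S |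
            complexBetti.map (Motives.fiberι f t) (2 * p) A ∈
              algebraicClasses (Motives.fiberOver f t) p} = ⋃ d, T d := by
  obtain ⟨W, hW, hL⟩ := hF f n p h𝒳 hS hSsm hf A
  exact exists_monotone_isZariskiClosedOnPoints_of_eq_iUnion W hW hL

/-- **The same for families projective in Hartshorne's sense** — `f` factors through a closed
immersion `ι : 𝒳 ↪ ℙᴺ × S` over `S` (the shape used by `Andre1996_deformation`) — over a smooth
quasi-projective base: the total space is then quasi-projective
(`IsQuasiProjectiveOver.of_isClosedImmersion_projectiveSpace_tensor`, Hartshorne II §4), so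
`exists_monotone_strata` applies. [cite: CharlesSchnell2014Notes, Prop. 11.3.11 (proof)]
[cite: Hartshorne1977, Ch. II §4 (p. 103)] -/
theorem exists_monotone_strata_of_isClosedImmersion
    (hι : ∃ (N : ℕ) (ι : 𝒳 ⟶ Motives.projectiveSpace N ℂ ⊗ S),
      IsClosedImmersion ι.left ∧ ι ≫ snd (Motives.projectiveSpace N ℂ) S = f)
    (hS : IsQuasiProjectiveOver S) (hSsm : AlgebraicGeometry.Smooth S.hom)
    (hf : Motives.IsSmoothProjectiveFamily f n) (p : ℕ) (A : complexBetti 𝒳 (2 * p)) :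
    ∃ T : ℕ → Set (Motives.ComplexPoints S), Monotone T ∧
      (∀ d, Motives.IsZariskiClosedOnPoints S (T d)) ∧
        {t : Motives.ComplexPoints S |
            complexBetti.map (Motives.fiberι f t) (2 * p) A ∈
              algebraicClasses (Motives.fiberOver f t) p} = ⋃ d, T d := by
  obtain ⟨N, ι, hιc, -⟩ := hι
  haveI := hιc
  exact exists_monotone_strata hF f
    (IsQuasiProjectiveOver.of_isClosedImmersion_projectiveSpace_tensor ι hS) hS hSsm hf p A

end charlesSchnell_algebraicityLocus_iUnion_closed

end HodgeTheory

end Literature.AlgebraicGeometry.HodgeTheory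

end
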